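import Mathlib
import HarnessLib
import Summits.ValiantsHypothesis.ValiantsHypothesis.Theorems.LacunarySymmetroidMatrixDescartesOsculationLawPeelBranchArc
import Summits.ValiantsHypothesis.ValiantsHypothesis.Theorems.LacunarySymmetroidMatrixDescartesOsculationLawPeelPigeonhole
import Summits.ValiantsHypothesis.ValiantsHypothesis.Theorems.LacunarySymmetroidMatrixDescartesOsculationLawPeelBranchRegularity

/-!
# ValiantsHypothesis / LacunarySymmetroid — crux `MatrixDescartes` (stmt-ValiantsHypothesis-18050, V1),
# line `Cruxes/MatrixDescartes/Lines/osculation_law.lean` («osculation-law»), stub `stub_peel` (ALL ranks):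
# ROOTS ON ONE BRANCH COMPONENT (rank-free; piece (γ2) of NOTE-p7g12-peel-general-r-sizing.md §6)

For a hyperbolic family in the line's general position (osculation set finite, `∂_bΦ ≠ 0` on it and off the arc
`b = c t^N`): along ANY continuous positive solution `b = β(t)` of `Φ = 0` on an interval `(α, ω)`, `α ≥ 0`, the number of
roots `t` of `g(t) = Φ(t, c t^N)` at which the arc meets this branch is at most `2·(#{osculation points on the branch} + 1)`
— the rank-free form of `branch_arc_count_two` + the per-branch pigeonhole of `peel_curve_two`: the branch is smooth
(`hasDerivAt_of_solution`), simple (`∂_bΦ ≠ 0`, from `rootMultiplicity_le_one_of_finite`), its own osculation abscissae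
cut `(α, ω)` into arcs free of osculation on which the ENGINE `card_roots_filter_branchArc_le_two` allows ≤ 2 meetings, the
meetings avoid the cuts by general position, and `card_le_mul_card_cuts_succ` adds up.

* `eval_pderiv_one_ne_zero_of_hyperbolic` — `∂_bΦ ≠ 0` at every curve point of the open quadrant.
* **`card_roots_on_branch_le`** — the statement above.

Honest framing: a rank-free LEMMA toward the OPEN stub `stub_peel` (all `r`); nothing of the summit is proved; `VP ≠ VNP` is
NOT proved.  No definitions, no named facts.
-/

-- `Summit.ValiantsHypothesis.ValiantsHypothesis.…` is the tree's mandated single-conjunct layout (Sub = Summit).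
set_option linter.dupNamespace false

noncomputable section

namespace Summit.ValiantsHypothesis.ValiantsHypothesis.Theorems.LacunarySymmetroidMatrixDescartes

open Polynomial Set Filter
open MvPolynomial (pderiv)
open scoped BigOperators Topology

namespace OsculationPeel

section

variable (Φ : MvPolynomial (Fin 2) ℝ) (P : ℝ → ℝ[X])
    (hP : ∀ t b, (P t).eval b = MvPolynomial.eval ![t, b] Φ) (hsplit : ∀ t, 0 < t → (P t).Splits)
    (hfin : {p : Fin 2 → ℝ | 0 < p 0 ∧ 0 < p 1 ∧ MvPolynomial.eval p Φ = 0 ∧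
      MvPolynomial.eval p
        (MvPolynomial.X 0 * MvPolynomial.pderiv 0 (MvPolynomial.X 0 * MvPolynomial.pderiv 0 Φ)
            * (MvPolynomial.X 1 * MvPolynomial.pderiv 1 Φ) ^ 2
          - 2 * (MvPolynomial.X 0 * MvPolynomial.pderiv 0 (MvPolynomial.X 1 * MvPolynomial.pderiv 1 Φ))
            * (MvPolynomial.X 0 * MvPolynomial.pderiv 0 Φ) * (MvPolynomial.X 1 * MvPolynomial.pderiv 1 Φ)
          + MvPolynomial.X 1 * MvPolynomial.pderiv 1 (MvPolynomial.X 1 * MvPolynomial.pderiv 1 Φ)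
            * (MvPolynomial.X 0 * MvPolynomial.pderiv 0 Φ) ^ 2) = 0}.Finite)

include hP hsplit hfin

/-- Under «`∂_bΦ ≠ 0` on the osculation set», `∂_bΦ ≠ 0` at EVERY curve point of the open quadrant (the root is simple).
[folklore] -/
theorem eval_pderiv_one_ne_zero_of_hyperbolic
    (hgp : ∀ p ∈ {p : Fin 2 → ℝ | 0 < p 0 ∧ 0 < p 1 ∧ MvPolynomial.eval p Φ = 0 ∧
      MvPolynomial.eval p
        (MvPolynomial.X 0 * MvPolynomial.pderiv 0 (MvPolynomial.X 0 * MvPolynomial.pderiv 0 Φ)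
            * (MvPolynomial.X 1 * MvPolynomial.pderiv 1 Φ) ^ 2
          - 2 * (MvPolynomial.X 0 * MvPolynomial.pderiv 0 (MvPolynomial.X 1 * MvPolynomial.pderiv 1 Φ))
            * (MvPolynomial.X 0 * MvPolynomial.pderiv 0 Φ) * (MvPolynomial.X 1 * MvPolynomial.pderiv 1 Φ)
          + MvPolynomial.X 1 * MvPolynomial.pderiv 1 (MvPolynomial.X 1 * MvPolynomial.pderiv 1 Φ)
            * (MvPolynomial.X 0 * MvPolynomial.pderiv 0 Φ) ^ 2) = 0},
        MvPolynomial.eval p (MvPolynomial.pderiv 1 Φ) ≠ 0)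
    {t b : ℝ} (ht : 0 < t) (hb : 0 < b) (hΦ : MvPolynomial.eval ![t, b] Φ = 0) :
    MvPolynomial.eval ![t, b] (pderiv 1 Φ) ≠ 0 := by
  intro hΦ1
  have hP0 : P t ≠ 0 := fun h0 => not_finite_of_vanishing_fibre Φ P hP ht h0 hfin
  have hle := rootMultiplicity_le_one_of_finite Φ P hP hsplit hfin hgp ht hb
  have hroot : (P t).IsRoot b := by rw [IsRoot, hP]; exact hΦ
  have hder : (derivative (P t)).IsRoot b := by rw [IsRoot, ← eval_pderiv_one_eq_derivative Φ P hP]; exact hΦ1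
  have hlt : 1 < (P t).rootMultiplicity b := by
    rw [one_lt_rootMultiplicity_iff_isRoot_iterate_derivative hP0]
    intro m hm
    interval_cases m
    · exact hroot
    · exact hder
  omega

/-- **Roots on one branch component.**  Along a continuous positive solution `β` on `(α, ω)`, `α ≥ 0`, the arc `b = c t^N`
meets the branch at no more than `2·(#{osculation points on the branch over (α, ω)} + 1)` roots of `g`. [folklore] -/
theorem card_roots_on_branch_le (c : ℝ) (N : ℕ) (g : ℝ[X])
    (hg : ∀ t, g.eval t = MvPolynomial.eval ![t, c * t ^ N] Φ)
    (hgp : ∀ p ∈ {p : Fin 2 → ℝ | 0 < p 0 ∧ 0 < p 1 ∧ MvPolynomial.eval p Φ = 0 ∧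
      MvPolynomial.eval p
        (MvPolynomial.X 0 * MvPolynomial.pderiv 0 (MvPolynomial.X 0 * MvPolynomial.pderiv 0 Φ)
            * (MvPolynomial.X 1 * MvPolynomial.pderiv 1 Φ) ^ 2
          - 2 * (MvPolynomial.X 0 * MvPolynomial.pderiv 0 (MvPolynomial.X 1 * MvPolynomial.pderiv 1 Φ))
            * (MvPolynomial.X 0 * MvPolynomial.pderiv 0 Φ) * (MvPolynomial.X 1 * MvPolynomial.pderiv 1 Φ)
          + MvPolynomial.X 1 * MvPolynomial.pderiv 1 (MvPolynomial.X 1 * MvPolynomial.pderiv 1 Φ)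
            * (MvPolynomial.X 0 * MvPolynomial.pderiv 0 Φ) ^ 2) = 0},
        MvPolynomial.eval p (MvPolynomial.pderiv 1 Φ) ≠ 0 ∧ p 1 ≠ c * p 0 ^ N)
    {α ω : ℝ} {β : ℝ → ℝ} (hα : 0 ≤ α) (hcont : ContinuousOn β (Ioo α ω))
    (hpos : ∀ t ∈ Ioo α ω, 0 < β t) (hsol : ∀ t ∈ Ioo α ω, MvPolynomial.eval ![t, β t] Φ = 0) :
    Multiset.card (g.roots.filter (fun t => α < t ∧ t < ω ∧ β t = c * t ^ N)) ≤
      2 * ((hfin.toFinset.filter (fun p => α < p 0 ∧ p 0 < ω ∧ p 1 = β (p 0))).card + 1) := by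
  classical
  set O := hfin.toFinset.filter (fun p => α < p 0 ∧ p 0 < ω ∧ p 1 = β (p 0)) with hO
  set cuts : Finset ℝ := O.image (fun p => p 0) with hcuts
  have hgp1 := fun p hp => (hgp p hp).1
  have hD := hasDerivAt_of_solution Φ P hP hsplit hfin hgp1 hα hcont hpos hsol
  -- pigeonhole over the branch's own osculation abscissae
  have key : Multiset.card (g.roots.filter (fun t => α < t ∧ t < ω ∧ β t = c * t ^ N)) ≤ 2 * (cuts.card + 1) := by
    by_cases hg0 : g = 0
    · simp [hg0]
    refine card_le_mul_card_cuts_succ _ cuts 2 (fun t ht => ?_) (fun t ht => ?_) (fun L U hL hfree => ?_)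
    · exact hα.trans_lt (Multiset.mem_filter.1 ht).2.1
    · -- meetings avoid the cuts: an osculation point ON the arc is excluded by general position
      obtain ⟨-, h1, h2, h3⟩ := Multiset.mem_filter.1 ht
      intro hmem
      obtain ⟨p, hp, hp0⟩ := Finset.mem_image.1 hmem
      obtain ⟨hposc, -, -, hp1⟩ := Finset.mem_filter.1 hp
      refine (hgp p ((Set.Finite.mem_toFinset hfin).1 hposc)).2 ?_
      rw [hp1, hp0, h3]
    · -- an arc free of own osculation: the ENGINE on `(max L α, min U ω)`
      have hα' : 0 ≤ max L α := le_max_of_le_left hL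
      have hsub : Ioo (max L α) (min U ω) ⊆ Ioo α ω := fun s hs =>
        ⟨(le_max_right _ _).trans_lt hs.1, hs.2.trans_le (min_le_right _ _)⟩
      have hE := card_roots_filter_branchArc_le_two Φ g c N hα' β (deriv β) (deriv (deriv β)) hg
        (fun s hs => (hD s (hsub hs)).1) (fun s hs => (hD s (hsub hs)).2) (fun s hs => hpos s (hsub hs))
        (fun s hs => hsol s (hsub hs))
        (fun s hs => eval_pderiv_one_ne_zero_of_hyperbolic Φ P hP hsplit hfin hgp1 (hα'.trans_lt hs.1) (hpos s (hsub hs))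
          (hsol s (hsub hs)))
        (fun s hs hH => ?_) (ω := min U ω)
      · refine le_trans (Multiset.card_le_card ?_) hE
        rw [Multiset.filter_filter]
        refine Multiset.monotone_filter_right g.roots ?_
        intro t ⟨⟨h1, h2⟩, h3, h4, h5⟩
        exact ⟨max_lt h1 h3, lt_min h2 h4, h5⟩
      · -- an osculation point of the branch inside the free arc: contradiction
        have hmem : (![s, β s] : Fin 2 → ℝ) ∈ O := by
          refine Finset.mem_filter.2 ⟨(Set.Finite.mem_toFinset hfin).2 ⟨?_, ?_, hsol s (hsub hs), hH⟩, ?_, ?_, ?_⟩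
          · simpa using hα'.trans_lt hs.1
          · simpa using hpos s (hsub hs)
          · simpa using (hsub hs).1
          · simpa using (hsub hs).2
          · simp
        exact hfree s (Finset.mem_image.2 ⟨_, hmem, by simp⟩) ⟨(le_max_left _ _).trans_lt hs.1, hs.2.trans_le (min_le_left _ _)⟩
  exact key.trans (Nat.mul_le_mul_left 2 (Nat.add_le_add_right Finset.card_image_le 1))

end

end OsculationPeel

end Summit.ValiantsHypothesis.ValiantsHypothesis.Theorems.LacunarySymmetroidMatrixDescartes

end
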